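import Mathlib
import Summits.Ventures.PercRepro2.Defs
import Summits.Ventures.PercRepro2.Harris
import Summits.Ventures.PercRepro2.CoinDefs
import Summits.Ventures.PercRepro2.CoinInduced
import Summits.Ventures.PercRepro2.CoinLsmCoreDefs
import Summits.Ventures.PercRepro2.CoinLsmCoreU
import Summits.Ventures.PercRepro2.CoinOrTailKDefs
import Summits.Ventures.PercRepro2.CoinOrTailKSums
import Summits.Ventures.PercRepro2.CoinKSureCoinsAlg
import Summits.Ventures.PercRepro2.CoinSubdivide
import Summits.Ventures.PercRepro2.CoinKSureSubOrTail


/-!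
# The cluster law of the subdivided OR-tail's core is log-supermodular (blind cell PercRepro2,
night-2 g15; proofs/NIGHT2-DARC.md §52)

`subCore U S₀ = U.map inl ∪ S₀.map inr` is the core of the subdivided system
(`CoinKSureSubOrTail`); its cluster law `subLaw` is the old law on `U.map inl`
(`coreLevel_sub_preimage`) times one coin factor per subdivided entry coin (`subLaw_insert`, the
level factorisation of the one-entry OR-tail `orTailK_sub_step`), hence log-supermodular by
`extLaw_lsm` (`subCore_lsm`).
-/

namespace Summit.Ventures.PercRepro2.Coin

open Classical

section SubCoreLsm

variable {V : Type*} {E : Type*} [DecidableEq V] [Fintype E] [DecidableEq E]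
  {R : Type*} [Field R] [LinearOrder R] [IsStrictOrderedRing R]
  {arcs : E → Finset (V × V)} {s : V} {U : Finset V} {ent : Finset V} {c : V → E} {a : V}

omit [DecidableEq V] [Fintype E] [DecidableEq E] in
/-- Membership of an old vertex in the image of an old set. -/
lemma inl_mem_map_inl {W : Finset V} {v : V} :
    Sum.inl v ∈ W.map (Function.Embedding.inl : V ↪ V ⊕ E) ↔ v ∈ W := by
  constructor
  · intro h
    obtain ⟨u, hu, huv⟩ := Finset.mem_map.1 h
    have huv' : Sum.inl u = Sum.inl v := huv
    rw [← Sum.inl_injective huv']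
    exact hu
  · intro hv
    exact Finset.mem_map.2 ⟨v, hv, rfl⟩

omit [Fintype E] in
/-- The level of an old core in the subdivided system pulls back to the old level. -/
lemma coreLevel_sub_preimage {S : Finset E} {src tgt : E → V}
    (hS : ∀ e ∈ S, arcs e = {(src e, tgt e)}) (C W : Finset V) :
    extC ⁻¹' coreLevel (subArcs arcs S src tgt) (Sum.inl s) (C.map Function.Embedding.inl)
        (W.map Function.Embedding.inl) = coreLevel arcs s C W := by
  ext ω
  rw [Set.mem_preimage, mem_coreLevel, mem_coreLevel]
  constructor
  · intro h z hz
    have := h (Sum.inl z) (Finset.mem_map.2 ⟨z, hz, rfl⟩)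
    rw [reach_sub_iff hS, inl_mem_map_inl] at this
    exact this
  · intro h z' hz'
    obtain ⟨z, hz, rfl⟩ := Finset.mem_map.1 hz'
    have := h z hz
    rw [← inl_mem_map_inl (E := E), ← reach_sub_iff hS] at this
    exact this

/-- The cluster law of the extended core `subCore U S₀` in the subdivided system. -/
noncomputable def subLaw (pr : E → R) (arcs : E → Finset (V × V)) (s : V) (U ent : Finset V)
    (c : V → E) (a : V) (S₀ : Finset E) (W : Finset (V ⊕ E)) : R :=
  prob (subPr pr) (coreLevel (subArcs arcs (ent.image c) (srcOf ent c s) (fun _ => a))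
    (Sum.inl s) (subCore U S₀) W)

omit [LinearOrder R] [IsStrictOrderedRing R] in
/-- **One step of the factorisation**: the law of the core extended by `inr e` is the law of
the previous core times the coin factor of `e`. -/
lemma subLaw_insert (pr : E → R) (h : OrTailK arcs s U ent c a) {S₀ : Finset E} {e : E}
    (he : e ∈ ent.image c) (heS₀ : e ∉ S₀) (W : Finset (V ⊕ E)) :
    subLaw pr arcs s U ent c a (insert e S₀) W =
      subLaw pr arcs s U ent c a S₀ (W ∩ subCore U S₀) *
        (if Sum.inr e ∈ W then (if Sum.inl (srcOf ent c s e) ∈ W then pr e else 0)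
          else (if Sum.inl (srcOf ent c s e) ∈ W then 1 - pr e else 1)) := by
  have hstep := orTailK_sub_step h (S₀ := S₀) he heS₀
  unfold subLaw
  rw [subCore_insert, hstep.prob_coreLevel_eq (subPr pr) W, hstep.prob_tailEventK (subPr pr) W]
  have htw : tailWtK (subPr pr) {Sum.inl (srcOf ent c s e)} (fun _ => Sum.inl e) W =
      1 - pr e * (if Sum.inl (srcOf ent c s e) ∈ W then 1 else 0) := by
    unfold tailWtK
    rw [Finset.prod_singleton]
    rfl
  rw [htw]
  split_ifs <;> ring

/-- **The extended core is log-supermodular** (induction on `S₀`, one virtual vertex at a time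
by `extLaw_lsm`). -/
theorem subCore_lsm (pr : E → R) (hp : IsProbVec pr) (h : OrTailK arcs s U ent c a)
    (hν : ∀ W W', W ⊆ U → W' ⊆ U →
      prob pr (coreLevel arcs s U W) * prob pr (coreLevel arcs s U W') ≤
        prob pr (coreLevel arcs s U (W ∩ W')) * prob pr (coreLevel arcs s U (W ∪ W')))
    (S₀ : Finset E) :
    S₀ ⊆ ent.image c → ∀ W₁ ⊆ subCore U S₀, ∀ W₂ ⊆ subCore U S₀,
      subLaw pr arcs s U ent c a S₀ W₁ * subLaw pr arcs s U ent c a S₀ W₂ ≤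
        subLaw pr arcs s U ent c a S₀ (W₁ ∩ W₂) * subLaw pr arcs s U ent c a S₀ (W₁ ∪ W₂) := by
  induction S₀ using Finset.induction_on with
  | empty =>
    intro _ W₁ hW₁ W₂ hW₂
    have hc : subCore U (∅ : Finset E) = U.map Function.Embedding.inl := by
      simp [subCore]
    rw [hc] at hW₁ hW₂
    obtain ⟨W₁₀, hW₁₀, rfl⟩ := Finset.subset_map_iff.1 hW₁
    obtain ⟨W₂₀, hW₂₀, rfl⟩ := Finset.subset_map_iff.1 hW₂
    simp only [subLaw, hc]
    rw [← Finset.map_inter, ← Finset.map_union, prob_sub, prob_sub, prob_sub, prob_sub,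
      coreLevel_sub_preimage h.arcs_entry, coreLevel_sub_preimage h.arcs_entry,
      coreLevel_sub_preimage h.arcs_entry, coreLevel_sub_preimage h.arcs_entry]
    exact hν W₁₀ W₂₀ hW₁₀ hW₂₀
  | insert e S₀ heS₀ ih =>
    intro hsub W₁ hW₁ W₂ hW₂
    have hS₀ : S₀ ⊆ ent.image c := (Finset.subset_insert e S₀).trans hsub
    have he : e ∈ ent.image c := hsub (Finset.mem_insert_self e S₀)
    rw [subCore_insert] at hW₁ hW₂
    have key := extLaw_lsm (subCore U S₀) (subLaw pr arcs s U ent c a S₀)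
      (Sum.inl (srcOf ent c s e)) (Sum.inr e) (pr e) (hp.nonneg e) (hp.le_one e)
      (fun W => prob_nonneg (isProbVec_subPr hp) _) (ih hS₀) W₁ hW₁ W₂ hW₂
    rw [subLaw_insert pr h he heS₀ W₁, subLaw_insert pr h he heS₀ W₂,
      subLaw_insert pr h he heS₀ (W₁ ∩ W₂), subLaw_insert pr h he heS₀ (W₁ ∪ W₂)]
    exact key

end SubCoreLsm

end Summit.Ventures.PercRepro2.Coin
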